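import Literature.AlgebraicGeometry.ShimuraVarieties.UnitaryAuxiliaryReflexConormTypeNormIdeal     -- ★ (B0) `il(g(con s))` read on `F`, inverse form (+ ★ conorm transport)
import Literature.NumberTheory.NumberFields.LocalFrobeniusArtinCorrespondent                       -- ★ `exists_isArtinCorrespondent_of_isAbsArithFrob` (`(ϖ_w⁻¹)_w ↔ ρσρ⁻¹`)
import Literature.NumberTheory.NumberFields.RayClassFieldIdelic                                     -- ★ `coe_toIdealUnits_single_of_valuation_eq` (`il(⟨ϖ⟩_w) = 𝔭_w`), `single_mem_trivialAt`
import Literature.NumberTheory.ComplexMultiplication.ReflexNormIdelesLocalIntegrality               -- ★ `reflexNormFiniteIdele_mem_trivialAt`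
import Literature.NumberTheory.GaloisRepresentations.ArtinCharacterLocalGlobalProofs                -- ★ `valued_eq_exp_neg_one_of_isUniformizer`
import Literature.FieldTheory.AlgClosed.AdicCompletionAlgClosureEquivComplex                        -- ★ p849445 `F̄_w ≃ ℂ` over `ι₁`
import Literature.FieldTheory.AlgClosed.AutomorphismExtension                                        -- ★ `exists_ringEquiv_apply_eq`
import HarnessLib

/-!
# Crux `HLiu418` — sub-line F0-P6a, (S8) `stub_ESHEET`, organ (S6)⊕(S7) «TWIST DATA»: THE SHEET TWIST ON THE FROBENIUS COSET (junction leg `h₀adm`)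

Cell `hodgecm-mathlib` (D-0151), crux `stmt-HodgeConjecture-24832` (hLiu418), `--supports` (count-neutral).  «L4» LA4-plan (g2) DEAL #30 (`stub_TWIST`) →
LA4-p05 (g4): the FROBENIUS LEG `h₀adm` of the one-call zip ★ `F0P6aTwistDataOfKottRows.exists_twistData_letterRows_of_kottRows` at the admissibility
`Adm := IsSheetTwistOf ι₁ τE Φ hΦ N` of the (S8) closer skeleton v2 (934d75ea, orientation `z = t(sE)`): for `γ ∈ Gal(Fᵢ∕F)` read from an ARITHMETIC FROBENIUS
`σ ∈ Γ_{F_w}` on the datum sheet `e : Fᵢ → F̄_w` (`σ ∘ e = e ∘ γ`), the junction witnesses for the Shimura–Taniyama twist `𝔞_can⁻¹` — UNFOLDED, with the (S7) pin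
«`g_F(𝔭_w) = 𝔞_can`» as a NAMED INPUT `hcan` (LA4-p04 (g2) (S7-F), ★ p849648 `canonicalTwistIdeal_eq_idealReflexTypeNorm_sigma` at `Lg := F` + the type identity under
`KottAdaptedAt`): a lift `γ′ := ρ σ ρ⁻¹ ∈ Aut(ℂ)` of `γ` through `τE` fixing `ι₁F` (`ρ : F̄_w ≃ ℂ` with `ρ ∘ e = τE`), the EXACT `E♯`-correspondent
`sE := con_{E♯/F}((ϖ_w⁻¹)_w) ↔ γ′`, `il(g_{Φ′}(sE)) = g_F(𝔭_w)⁻¹ = 𝔞⁻¹`, and `g_{Φ′}(sE) = 1` at every prime of `(N)` (`p ∤ N`).  THEOREMS ONLY; no `Cruxes/…/Lines` import.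

ROAD ([Shimura1998] §18.6 proof p. 128 «its `𝔭`-component is a prime element … all other components are `1`»; [MilneCM2006] Ch. I Prop. 1.26; [Milne2005ShimuraVarieties] (59)):
`ρ₀ : F̄_w ≃ ℂ` over `ι₁` (★ p849445) corrected inside `Aut(ℂ)` so that `ρ ∘ e = τE` (★ `exists_ringEquiv_apply_eq`, `Fᵢ` countable); `(ϖ_w⁻¹)_w ↔ ρσρ⁻¹` over `(F, ι₁)`
(★ g3 `exists_isArtinCorrespondent_of_isAbsArithFrob`, Deligne՚s normalisation `art = rec⁻¹`); conorm transport to `E♯ = ι₁F` (★ p850225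
`isArtinCorrespondent_finiteIdeleConorm_of_hasSmallReflex`); `il((ϖ_w)_w) = 𝔭_w` (★ `coe_toIdealUnits_single_of_valuation_eq`, ★ `valued_eq_exp_neg_one_of_isUniformizer`)
and `il(g(con s)) = g_F(il s)` (★ p850248 `…_of_eq_coeIdeal_inv`); triviality at `(N)`: `(ϖ_w⁻¹)_w ∈ J^{(N)}` since `(N) ⊄ 𝔭_w` (`p ∈ 𝔭_w`, `p ∤ N`; ★
`single_mem_trivialAt`), preserved by `con` (★ p850225) and by `g_f` prime by prime (★ `reflexNormFiniteIdele_mem_trivialAt`).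
HONEST LABEL.  HC_CM is proved only modulo the 7 printed citations (2 remaining named inputs: hLiu418 = stmt-HodgeConjecture-24832, h413 = stmt-HodgeConjecture-24833)
until rung 0 closes; nothing here changes a count.
[cite: Shimura1998, §18.6 proof pp. 127–129; §13.1 Thm. 1 (1), (7) pp. 97–99] [cite: MilneCM2006, Ch. I §1 Rem. 1.25, Prop. 1.26 (11)]
[cite: Milne2005ShimuraVarieties, (59) p. 107; Def. 12.8 (62) p. 114] [cite: NeukirchANT1999, Ch. VI §5 Prop. (5.6), Cor. (5.7)]
-/

set_option autoImplicit false
set_option linter.dupNamespace false  -- `Summit.HodgeConjecture.HodgeConjecture.…` BY DESIGN (D-0017)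

noncomputable section

open NumberField IsDedekindDomain WithZero
open scoped Pointwise nonZeroDivisors Cardinal
open Literature.NumberTheory.GaloisRepresentations (modulusExp IsAbsArithFrob)
open Literature.NumberTheory.NumberFields (IdeleIdeal.coe_toIdealUnits exists_isArtinCorrespondent_of_isAbsArithFrob)
open Literature.AlgebraicGeometry.Motives (CMType)
open Literature.AlgebraicGeometry.ShimuraVarieties (UnitaryCanonicalModel.IsArtinCorrespondent)
open Literature.AlgebraicGeometry.ShimuraVarieties.UnitaryCanonicalModel
open Literature.AlgebraicGeometry.ShimuraVarieties.UnitaryCanonicalModel.Aux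
open Literature.NumberTheory.ComplexMultiplication
open Literature.NumberTheory.AdelicBaseChange (finiteIdeleConorm finiteIdeleConorm_mem_trivialAt_span_natCast)
open Literature.NumberTheory.Automorphic (uniformizerIdele)
open Literature.NumberTheory.Automorphic.FiniteAdeleRing (toFractionalIdeal)

namespace Summit.HodgeConjecture.HodgeConjecture.Theorems.F0P6aSheetTwistFrobenius

variable {F : Type} [Field F] [NumberField F] [IsCMField F]

/-! ### §1 Two small facts: the inverse-uniformiser idèle has ideal `𝔭_w⁻¹` and is trivial at `(N)` -/

omit [NumberField F] [IsCMField F] in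
/-- `(N) ⊄ 𝔭_w` when `p ∈ 𝔭_w` and `p ∤ N` (`p`, `N` coprime ⇒ `1 ∈ (p, N) ⊆ 𝔭_w` otherwise). [cite: NeukirchANT1999, Ch. I §8] -/
theorem not_span_natCast_le_of_prime_mem_of_not_dvd (w : HeightOneSpectrum (𝓞 F)) {p N : ℕ} (hp : p.Prime)
    (hpw : (p : 𝓞 F) ∈ w.asIdeal) (hpN : ¬ p ∣ N) : ¬ Ideal.span {((N : ℕ) : 𝓞 F)} ≤ w.asIdeal := by
  intro hle
  rw [Ideal.span_singleton_le_iff_mem] at hle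
  have hcop : IsCoprime (p : 𝓞 F) (N : 𝓞 F) := Nat.Coprime.cast ((Nat.Prime.coprime_iff_not_dvd hp).2 hpN)
  obtain ⟨a, b, hab⟩ := hcop
  have h1 : (1 : 𝓞 F) ∈ w.asIdeal := by
    rw [← hab]
    exact w.asIdeal.add_mem (w.asIdeal.mul_mem_left a hpw) (w.asIdeal.mul_mem_left b hle)
  exact w.isPrime.ne_top ((Ideal.eq_top_iff_one _).2 h1)

omit [IsCMField F] in
/-- `uniformizerIdele` IS `IdeleAction.single` (two names for `mulSingle` on units). [folklore] -/
theorem uniformizerIdele_eq_single (w : HeightOneSpectrum (𝓞 F)) (ϖ : (w.adicCompletion F)ˣ) :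
    uniformizerIdele F w ϖ = Literature.NumberTheory.NumberFields.IdeleAction.single w ϖ :=
  Units.ext rfl

omit [IsCMField F] in
/-- **`il((ϖ_w⁻¹)_w) = 𝔭_w⁻¹`** for a uniformiser `ϖ` of `F_w` (★ `coe_toIdealUnits_single_of_valuation_eq`, ★ `valued_eq_exp_neg_one_of_isUniformizer`).
[cite: Shimura1998, §18.6 proof p. 128 («since c𝔯 = 𝔭»)] [cite: CasselsFrohlichANT1967, Ch. II §17] -/
theorem toFractionalIdeal_uniformizerIdele_inv (w : HeightOneSpectrum (𝓞 F)) {ϖ : (w.adicCompletion F)ˣ}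
    (hϖ : (ValuativeRel.valuation (w.adicCompletion F)).IsUniformizer (ϖ : w.adicCompletion F)) :
    toFractionalIdeal (𝓞 F) F (uniformizerIdele F w ϖ)⁻¹ = ((w.asIdeal : FractionalIdeal (𝓞 F)⁰ F))⁻¹ := by
  have hv : Valued.v (ϖ : w.adicCompletion F) = exp (-1 : ℤ) :=
    Literature.NumberTheory.GaloisRepresentations.ArtinLocalGlobal.valued_eq_exp_neg_one_of_isUniformizer w hϖ
  rw [← IdeleIdeal.coe_toIdealUnits, map_inv, Units.val_inv_eq_inv_val, uniformizerIdele_eq_single,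
    Literature.NumberTheory.NumberFields.coe_toIdealUnits_single_of_valuation_eq hv]

omit [IsCMField F] in
/-- **`(ϖ_w⁻¹)_w` is trivial at the primes of `(N)`** when `p ∈ 𝔭_w`, `p ∤ N` (`w ∤ (N)`, component `1` off `w`). [cite: Shimura1998, §18.6 proof p. 128] -/
theorem uniformizerIdele_inv_mem_trivialAt (w : HeightOneSpectrum (𝓞 F)) (ϖ : (w.adicCompletion F)ˣ) {p N : ℕ} (hp : p.Prime)
    (hpw : (p : 𝓞 F) ∈ w.asIdeal) (hpN : ¬ p ∣ N) :
    (uniformizerIdele F w ϖ)⁻¹ ∈ Literature.NumberTheory.NumberFields.IdeleAction.trivialAt (K := F) (Ideal.span {((N : ℕ) : 𝓞 F)}) := by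
  refine inv_mem ?_
  rw [uniformizerIdele_eq_single]
  exact Literature.NumberTheory.NumberFields.IdeleAction.single_mem_trivialAt w ϖ (not_span_natCast_le_of_prime_mem_of_not_dvd w hp hpw hpN)

/-! ### §2 The sheet twist on the Frobenius coset -/

set_option maxHeartbeats 400000 in
/-- **THE SHEET TWIST ON THE FROBENIUS COSET (junction leg `h₀adm` of `stub_TWIST`, UNFOLDED, (S7) pin as input)**: for `F ∕ ℚ` Galois CM, `ι₁`, any CM type
`Φ′` (`E♯ := Aux.reflexField F Φ′ ι₁`), a slice field `Fᵢ ∕ F` with `τE ∣ ι₁`, a level `N`, a place `w` with `p ∈ 𝔭_w`, `p ∤ N`, a datum sheet `e : Fᵢ → F̄_w`, an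
ARITHMETIC FROBENIUS `σ ∈ Γ_{F_w}` and `γ ∈ Gal(Fᵢ∕F)` with `σ ∘ e = e ∘ γ`, and an ideal `𝔞` with `g_F(𝔭_w) = 𝔞` (`g_F = idealReflexTypeNorm (valuedIn ι₁ Φ′) id id`, the (S7)
pin): there are a lift `γ′ ∈ Aut(ℂ)` of `γ` through `τE` fixing `ι₁F` and an EXACT `E♯`-correspondent `sE ↔ γ′` with `il(g_{Φ′}(sE)) = 𝔞⁻¹` and `g_{Φ′}(sE) ≡ 1 mod (N)`
at the primes of `(N)` (indeed `= 1` there). [cite: Shimura1998, §18.6 proof pp. 127–129; §13.1 Thm. 1 (1), (7)] [cite: MilneCM2006, Ch. I §1 Prop. 1.26 (11)]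
[cite: Milne2005ShimuraVarieties, (59) p. 107; Def. 12.8 (62) p. 114] [cite: NeukirchANT1999, Ch. VI §5 Prop. (5.6), Cor. (5.7)] -/
theorem exists_sheetTwist_frobenius [IsGalois ℚ F] (ι₁ : F →+* ℂ) (Φ' : CMType F)
    {Fi : Type} [Field Fi] [NumberField Fi] [Algebra F Fi] (τE : Fi →+* ℂ) (hτE : τE.comp (algebraMap F Fi) = ι₁)
    (N : ℕ) (w : HeightOneSpectrum (𝓞 F)) {p : ℕ} (hp : p.Prime) (hpw : (p : 𝓞 F) ∈ w.asIdeal) (hpN : ¬ p ∣ N)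
    (e : Fi →ₐ[F] AlgebraicClosure (w.adicCompletion F))
    {σ : Field.absoluteGaloisGroup (w.adicCompletion F)} (hσ : IsAbsArithFrob σ) (γ : Fi ≃ₐ[F] Fi)
    (hσγ : ((AlgEquiv.restrictScalars F (Field.absoluteGaloisGroup.toAlgEquiv (w.adicCompletion F) σ) :
        AlgebraicClosure (w.adicCompletion F) ≃ₐ[F] AlgebraicClosure (w.adicCompletion F)) :
        AlgebraicClosure (w.adicCompletion F) →ₐ[F] AlgebraicClosure (w.adicCompletion F)).comp e = e.comp (γ : Fi →ₐ[F] Fi))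
    (𝔞 : Ideal (𝓞 F)) (hcan : idealReflexTypeNorm (valuedIn ι₁ Φ'.1) (RingHom.id F) (RingHom.id F) w.asIdeal = 𝔞) :
    haveI : NumberField ↥(reflexField F Φ' ι₁) := numberField_reflexField F Φ' ι₁
    ∃ (γ' : ℂ ≃+* ℂ) (sE : (FiniteAdeleRing (𝓞 ↥(reflexField F Φ' ι₁)) ↥(reflexField F Φ' ι₁))ˣ),
      (∀ x : Fi, γ' (τE x) = τE (γ x)) ∧ (∀ x : F, γ' (ι₁ x) = ι₁ x) ∧
      IsArtinCorrespondent ↥(reflexField F Φ' ι₁) (algebraMap ↥(reflexField F Φ' ι₁) ℂ) sE γ' ∧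
      toFractionalIdeal (𝓞 F) F (reflexNormFiniteIdele F Φ' (reflexField F Φ' ι₁) sE) = ((𝔞 : FractionalIdeal (𝓞 F)⁰ F))⁻¹ ∧
      (∀ v : HeightOneSpectrum (𝓞 F), Ideal.span {((N : ℕ) : 𝓞 F)} ≤ v.asIdeal →
        Valued.v ((reflexNormFiniteIdele F Φ' (reflexField F Φ' ι₁) sE : FiniteAdeleRing (𝓞 F) F) v) = 1 ∧
        Valued.v ((reflexNormFiniteIdele F Φ' (reflexField F Φ' ι₁) sE : FiniteAdeleRing (𝓞 F) F) v - 1) ≤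
          exp (-(modulusExp (Ideal.span {((N : ℕ) : 𝓞 F)}) v : ℤ))) := by
  classical
  haveI : NumberField ↥(reflexField F Φ' ι₁) := numberField_reflexField F Φ' ι₁
  letI : Algebra F ↥(reflexField F Φ' ι₁) := (toReflexField F Φ' ι₁).toAlgebra
  -- (1) `ρ : F̄_w ≃ ℂ` with `ρ ∘ e = τE` (hence `ρ ∘ (F → F̄_w) = ι₁`)
  obtain ⟨ρ₀, hρ₀⟩ :=
    Literature.FieldTheory.AlgClosed.exists_ringEquiv_algebraicClosure_adicCompletion_complex_comp_eq F w ι₁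
  have hℵ : ℵ₀ < #ℂ := by rw [Cardinal.mk_complex]; exact Cardinal.aleph0_lt_continuum
  have hFi : #Fi ≤ ℵ₀ := by
    haveI : Countable Fi := Countable.of_equiv _ (Module.finBasis ℚ Fi).equivFun.toEquiv.symm
    exact Cardinal.mk_le_aleph0
  obtain ⟨θ, hθ⟩ := Literature.FieldTheory.AlgClosed.exists_ringEquiv_apply_eq hℵ hFi
    ((ρ₀ : AlgebraicClosure (w.adicCompletion F) →+* ℂ).comp (e : Fi →+* AlgebraicClosure (w.adicCompletion F))) τE
  set ρ : AlgebraicClosure (w.adicCompletion F) ≃+* ℂ := ρ₀.trans θ with hρdef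
  have hρe : ∀ x : Fi, ρ (e x) = τE x := fun x => hθ x
  have hρ : (ρ : AlgebraicClosure (w.adicCompletion F) →+* ℂ).comp (algebraMap F (AlgebraicClosure (w.adicCompletion F))) = ι₁ := by
    refine RingHom.ext fun x => ?_
    rw [RingHom.comp_apply, ← hτE, RingHom.comp_apply, ← hρe, AlgHom.commutes]
    rfl
  -- (2) the `F`-correspondent `(ϖ_w⁻¹)_w ↔ γ′ := ρσρ⁻¹`
  obtain ⟨ϖ, hϖ, hs⟩ := exists_isArtinCorrespondent_of_isAbsArithFrob w ι₁ hσ ρ hρ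
  set γ' : ℂ ≃+* ℂ := (ρ.symm.trans (Field.absoluteGaloisGroup.toAlgEquiv (w.adicCompletion F) σ).toRingEquiv).trans ρ with hγ'
  have hγ'apply : ∀ z : ℂ, γ' z = ρ (Field.absoluteGaloisGroup.toAlgEquiv (w.adicCompletion F) σ (ρ.symm z)) := fun _ => rfl
  have hlift : ∀ x : Fi, γ' (τE x) = τE (γ x) := by
    intro x
    have hσx : Field.absoluteGaloisGroup.toAlgEquiv (w.adicCompletion F) σ (e x) = e (γ x) := by
      have h := congrArg (fun f : Fi →ₐ[F] AlgebraicClosure (w.adicCompletion F) => f x) hσγ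
      exact h
    rw [hγ'apply, ← hρe x, RingEquiv.symm_apply_apply, hσx, hρe]
  have hfix : ∀ x : F, γ' (ι₁ x) = ι₁ x := by
    intro x
    have hιx : ι₁ x = ρ (algebraMap F (AlgebraicClosure (w.adicCompletion F)) x) := by
      rw [← hρ]; rfl
    rw [hγ'apply, hιx, RingEquiv.symm_apply_apply,
      IsScalarTower.algebraMap_apply F (w.adicCompletion F) (AlgebraicClosure (w.adicCompletion F)) x, AlgEquiv.commutes]
  -- (3) transport to `E♯` by the conorm
  set s : (FiniteAdeleRing (𝓞 F) F)ˣ := (uniformizerIdele F w ϖ)⁻¹ with hsdef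
  have hsm : HasSmallReflex F Φ' ι₁ := hasSmallReflex_of_isGalois F Φ' ι₁
  have hsE : IsArtinCorrespondent ↥(reflexField F Φ' ι₁) (algebraMap ↥(reflexField F Φ' ι₁) ℂ)
      (finiteIdeleConorm F ↥(reflexField F Φ' ι₁) s) γ' :=
    isArtinCorrespondent_finiteIdeleConorm_of_hasSmallReflex F Φ' ι₁ hsm γ' s hs
  -- (4) the ideal: `il(g(con s)) = g_F(𝔭_w)⁻¹ = 𝔞⁻¹`
  have hz : toFractionalIdeal (𝓞 F) F (reflexNormFiniteIdele F Φ' (reflexField F Φ' ι₁) (finiteIdeleConorm F ↥(reflexField F Φ' ι₁) s)) =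
      ((𝔞 : FractionalIdeal (𝓞 F)⁰ F))⁻¹ := by
    rw [toFractionalIdeal_reflexNormFiniteIdele_finiteIdeleConorm_of_eq_coeIdeal_inv F Φ' ι₁ s w.asIdeal w.ne_bot
      (toFractionalIdeal_uniformizerIdele_inv w hϖ), hcan]
  -- (5) triviality at `(N)`
  have htriv : reflexNormFiniteIdele F Φ' (reflexField F Φ' ι₁) (finiteIdeleConorm F ↥(reflexField F Φ' ι₁) s) ∈
      Literature.NumberTheory.NumberFields.IdeleAction.trivialAt (K := F) (Ideal.span {((N : ℕ) : 𝓞 F)}) :=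
    reflexNormFiniteIdele_mem_trivialAt F Φ' (reflexField F Φ' ι₁) N
      (finiteIdeleConorm_mem_trivialAt_span_natCast F ↥(reflexField F Φ' ι₁) N (uniformizerIdele_inv_mem_trivialAt w ϖ hp hpw hpN))
  refine ⟨γ', finiteIdeleConorm F ↥(reflexField F Φ' ι₁) s, hlift, hfix, hsE, hz, fun v hv => ?_⟩
  rw [htriv v hv, map_one, sub_self, map_zero]
  exact ⟨rfl, zero_le⟩

end Summit.HodgeConjecture.HodgeConjecture.Theorems.F0P6aSheetTwistFrobenius

end
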